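import Summits.Ventures.CertifiedArithmetic.LowPrec.DoubleRoundingFMABinade

/-!
# Double rounding of the FMA — the first binade above `W` decided exactly (THEOREM D-fma-M♯):
# the slip frame

HONEST FRAMING: certified error envelopes and provably optimal rounding/accumulation schemes for
low-precision formats under stated cost models; every table by two implementations; no hardware
or vendor claims.

Soundness of `fmaBinadeSlipTest` (`DoubleRoundingFMABinade.lean`): under the grid conditions of
THEOREM D-fma-M with `n ≥ m + 2` and a source maximum `M = (2^m + J)·2^(k+1)` quanta in the first
binade above `W = 2^(m+1+k)·quantum φ`, every slip of `fl_φ ∘ fl_ψ` at a positive `a·b + c`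
(`a·b ≠ 0`) is read back into the test (`binade_slip_sig`).  THE ANATOMY: `fl_ψ (a·b + c)` is a
midpoint `μ_t = (2t+1)·2^k·quantum φ`, `2^m ≤ t < 2^m + J` (`slip_midpoint_of_pos`, window A of
`slip_in_windows` being empty); the register's spacing on `[W, 2W)` is `2·quantum φ²` and `a·b`,
`c` are multiples of `quantum φ²`, so `a·b + c = μ_t + N·quantum φ²` with `N = ±1`, and the two
`φ`-roundings of `μ_t` and of `μ_t ∓ quantum φ²` (far side) agree (`toRat_roundNE_gmid[_odd]`,
`toRat_roundNE_below/above_gmid`), forcing `N = +1` for `t` even, `-1` for `t` odd; then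
`A·B = a·b/quantum φ²` is odd, `|A|, |B| < 2^(m+1)`, `|A·B| + 1 ≤ 2^(2m+2) ≤ 2^(m+n)`, so
`c·2^(m+bias-1)/quantum φ > 2^(m+n)`: `c = w·2^k·quantum φ` with `2^m < w ≤ 2^(m+1) + 2J` (even
once `w ≥ 2^(m+1)`), and `A·B = e·2^n + N`, `e = 2t + 1 - w`, `|e| ≤ 2^(2m+2-n)`.  The decision
and the instances are in `DoubleRoundingFMABinadeIff.lean`; implementation A:
`code/enum/fma_binade_law.py` → `DOUBLE-ROUNDING-FMA.md` §14.  PLACEMENT: the midpoint property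
[MartinDorelMelquiondMuller2013] Property 2.1; innocuous double rounding [Figueroa1995] §3,
[Roux2014] §2.  No hardware or vendor claims.
-/

namespace Summit.Ventures.CertifiedArithmetic

open Literature.ComputerArithmetic.FloatingPoint
open Literature.ComputerArithmetic.FloatingPoint.Format
open Literature.ComputerArithmetic.FloatingPoint.MiniFloat

/-! ## §1 The slip frame on the first binade above `W` -/

/-- THE ANATOMY OF A SLIP ON THE FIRST BINADE (soundness of the test).  Grids nested,
`2 P_φ ≤ P_ψ`, `bias φ ≤ bias ψ`, `L_ψ ≤ 2 L_φ`, `L_ψ + P_ψ ≤ L_φ`, `m ≥ 1`, `bias φ ≥ 1`,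
`m_ψ = m + n`, `n ≥ m + 2`, `k + m + bias φ = n + 1`, `M_φ = (2^m + J)·2^(k+1)` with `J ≤ 2^m`:
a slip of `fl_φ ∘ fl_ψ` at `a·b + c > 0` (`a·b ≠ 0`) passes `fmaBinadeSlipTest m n J` — with
`j = t - 2^m` the index of the midpoint `fl_ψ (a·b + c) = (2t+1)·2^k·quantum φ`, `e = 2t + 1 - w`
where `c = w·2^k·quantum φ`, and the factorization `|e·2^n ± 1| = |A|·|B|` read off
`a = A·quantum φ`, `b = B·quantum φ`. [cite: MartinDorelMelquiondMuller2013, Property 2.1] -/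
theorem binade_slip_sig {φ ψ : Format} (hE : embedsTest φ ψ = true)
    (hm : 2 * φ.manBits + 1 ≤ ψ.manBits) (hbias : φ.bias ≤ ψ.bias) (hq2 : ψ.qexp ≤ 2 * φ.qexp)
    (hnorm : ψ.qexp + ψ.manBits + 1 ≤ φ.qexp) (h1 : 1 ≤ φ.manBits) (hb : 1 ≤ φ.bias)
    {n k J : ℕ} (hn : ψ.manBits = φ.manBits + n) (hn2 : φ.manBits + 2 ≤ n)
    (hk : k + (φ.manBits + φ.bias) = n + 1) (hJ : J ≤ 2 ^ φ.manBits)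
    (hM : φ.maxScaled = (2 ^ φ.manBits + J) * 2 ^ (k + 1))
    {a b c : MiniFloat φ} (ha : a.scaledMag ≠ 0) (hb0 : b.scaledMag ≠ 0)
    (hx : 0 < a.toRat * b.toRat + c.toRat)
    (h : (roundNE φ (roundNE ψ (a.toRat * b.toRat + c.toRat)).toRat).toRat
      ≠ (roundNE φ (a.toRat * b.toRat + c.toRat)).toRat) :
    fmaBinadeSlipTest φ.manBits n J = true := by
  set x := a.toRat * b.toRat + c.toRat with hxdef
  have hQφ := φ.quantum_pos
  have hQψ := ψ.quantum_pos
  have hqq : 0 < φ.quantum * φ.quantum := mul_pos hQφ hQφ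
  have hq : ψ.qexp ≤ φ.qexp := by omega
  -- (1) the windows and the midpoint anatomy
  obtain ⟨hymax, hwin⟩ := slip_in_windows hE hm hbias hq2 hnorm ha hb0 hx h
  obtain ⟨zM, hzM⟩ := exists_toRat_eq_maxRat_of_test hE
  have hmax : φ.maxRat ≤ ψ.maxRat := hzM ▸ (le_abs_self _).trans (abs_toRat_le_maxRat zM)
  obtain ⟨v, u, hv0, hvx, hxu, hgap, hmid, hxm⟩ :=
    slip_midpoint_of_pos (by omega) hbias hmax hx h
  set y := roundNE ψ x with hydef
  obtain ⟨u', hu'⟩ := exists_toRat_eq_add_ulp hv0 (hvx.trans hxu)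
  have hueq : u.toRat = v.toRat + 2 ^ (v.expCode - 1) * φ.quantum := by
    have hule := add_ulp_le_of_lt hv0 (hvx.trans hxu)
    have hGpos : (0:ℚ) < 2 ^ (v.expCode - 1) * φ.quantum := by positivity
    rcases hgap u' with h0 | h0 <;> linarith
  have humax : u.toRat ≤ φ.maxRat := (le_abs_self _).trans (abs_toRat_le_maxRat u)
  have hyu : y.toRat < u.toRat := by rw [hmid]; linarith
  have hvy : v.toRat < y.toRat := by rw [hmid]; linarith
  have hy0 : 0 < y.toRat := lt_of_le_of_lt hv0 hvy
  -- (2) units: `2^n·q = 2^k`, `Q·q = 1`, `W = 2^(m+1+k)·q`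
  have hkey : (2 : ℚ) ^ n * φ.quantum = 2 ^ k := by
    rw [show n = k + (φ.manBits + (φ.bias - 1)) by omega, pow_add, mul_assoc,
      two_pow_mul_quantum_eq_one hb, mul_one]
  obtain ⟨Q, hQ⟩ : ∃ Q : ℕ, Q = 2 ^ (φ.manBits + (φ.bias - 1)) := ⟨_, rfl⟩
  have hQpos : 0 < Q := by rw [hQ]; positivity
  have hQq : (Q : ℚ) * φ.quantum = 1 := by
    rw [hQ]; push_cast; exact two_pow_mul_quantum_eq_one hb
  have hkQ : 2 ^ k * Q = 2 ^ n := by rw [hQ, ← pow_add]; congr 1; omega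
  have hkQz : (2 : ℤ) ^ k * Q = 2 ^ n := by exact_mod_cast hkQ
  have hWz : (2 : ℚ) ^ ((ψ.manBits : ℤ) + 1 + 2 * φ.qexp)
      = 2 ^ (φ.manBits + 1 + k) * φ.quantum := by
    unfold Format.quantum
    rw [← zpow_natCast, ← zpow_add₀ two_ne_zero]
    congr 1
    unfold Format.qexp; push_cast; omega
  -- (3) `W ≤ y` (window A is empty, window B starts at `W`)
  have hWy : (2 : ℚ) ^ (φ.manBits + 1 + k) * φ.quantum ≤ y.toRat := by
    rcases hwin with hA | ⟨-, hB⟩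
    · exfalso
      have h2 : φ.maxRat ≤ (2 : ℚ) ^ (ψ.manBits + 1) * φ.quantum := by
        unfold Format.maxRat
        rw [hM]; push_cast
        have hJq : (J : ℚ) ≤ 2 ^ φ.manBits := by exact_mod_cast hJ
        have : ((2 : ℚ) ^ φ.manBits + J) * 2 ^ (k + 1) ≤ 2 ^ (ψ.manBits + 1) :=
          calc ((2 : ℚ) ^ φ.manBits + J) * 2 ^ (k + 1)
              ≤ (2 ^ φ.manBits + 2 ^ φ.manBits) * 2 ^ (k + 1) := by gcongr
            _ = 2 ^ (φ.manBits + 1 + (k + 1)) := by rw [pow_add, pow_succ]; ring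
            _ ≤ 2 ^ (ψ.manBits + 1) := pow_le_pow_right₀ (by norm_num) (by omega)
        exact mul_le_mul_of_nonneg_right this hQφ.le
      linarith
    · rwa [hWz] at hB
  -- (4) `W ≤ v`
  have hWrep : φ.Representable (2 ^ φ.manBits * 2 ^ (k + 1)) :=
    representable_mul_pow (Nat.pow_lt_pow_right (by norm_num) (by omega))
      (by rw [hM]; exact Nat.mul_le_mul_right _ (Nat.le_add_right _ _))
  obtain ⟨w0, hw0⟩ := exists_toRat_eq_natMul hWrep
  have hw0' : w0.toRat = 2 ^ (φ.manBits + 1 + k) * φ.quantum := by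
    rw [hw0]; push_cast; simp only [pow_add, pow_one]; ring
  have hWv : (2 : ℚ) ^ (φ.manBits + 1 + k) * φ.quantum ≤ v.toRat := by
    rcases hgap w0 with h0 | h0
    · rwa [hw0'] at h0
    · rw [hw0'] at h0; linarith
  -- (5) `v = t·2^(k+1)`, `2^m ≤ t < 2^m + J`, `y = (2t+1)·2^k` (quanta of `φ`)
  have hvQ : v.toRat = (v.scaledMag : ℚ) * φ.quantum := by
    rw [toRat_eq_toInt_mul, toInt_eq_scaledMag_of_nonneg hv0]; push_cast; rfl
  have hVlo : 2 ^ (φ.manBits + 1 + k) ≤ v.scaledMag := by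
    have : ((2 ^ (φ.manBits + 1 + k) : ℕ) : ℚ) * φ.quantum ≤ (v.scaledMag : ℚ) * φ.quantum := by
      rw [← hvQ]; push_cast; exact hWv
    exact_mod_cast le_of_mul_le_mul_right this hQφ
  have hVhi : v.scaledMag < (2 ^ φ.manBits + J) * 2 ^ (k + 1) := by
    have : (v.scaledMag : ℚ) * φ.quantum
        < (((2 ^ φ.manBits + J) * 2 ^ (k + 1) : ℕ) : ℚ) * φ.quantum := by
      rw [← hvQ, ← hM]; exact lt_of_lt_of_le (hvx.trans hxu) humax
    exact_mod_cast lt_of_mul_lt_mul_right this hQφ.le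
  have hMpow : (2 ^ φ.manBits + J) * 2 ^ (k + 1) ≤ 2 ^ (φ.manBits + (k + 2)) :=
    calc (2 ^ φ.manBits + J) * 2 ^ (k + 1) ≤ (2 ^ φ.manBits + 2 ^ φ.manBits) * 2 ^ (k + 1) :=
          Nat.mul_le_mul_right _ (by omega)
      _ = 2 ^ (φ.manBits + (k + 2)) := by rw [← mul_two, ← pow_succ, ← pow_add]; congr 1; omega
  have hev : v.expCode - 1 = k + 1 := by
    have h3 : k + 1 ≤ v.expCode - 1 := succ_le_ulpExp_of_le_scaledMag hVlo
    have h4 := pow_le_scaledMag_of_expCode_pos v (by omega)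
    have h5 := (Nat.pow_lt_pow_iff_right (by norm_num)).mp
      (h4.trans_lt (hVhi.trans_le hMpow))
    omega
  obtain ⟨t, ht⟩ : ∃ t, v.scaledMag = t * 2 ^ (k + 1) := by
    obtain ⟨c', hc'⟩ := pow_ulpExp_dvd_scaledMag v
    exact ⟨c', by rw [hc', hev, mul_comm]⟩
  have htlo : 2 ^ φ.manBits ≤ t := by
    by_contra hlt
    push Not at hlt
    have h6 : t * 2 ^ (k + 1) < 2 ^ φ.manBits * 2 ^ (k + 1) :=
      Nat.mul_lt_mul_of_pos_right hlt (Nat.two_pow_pos _)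
    rw [← pow_add, show φ.manBits + (k + 1) = φ.manBits + 1 + k by omega, ← ht] at h6
    omega
  have htJ : t < 2 ^ φ.manBits + J := by
    rw [ht] at hVhi; exact Nat.lt_of_mul_lt_mul_right hVhi
  have hthi : t < 2 ^ (φ.manBits + 1) := by rw [pow_succ]; omega
  have hu1 : (t + 1) * 2 ^ (k + 1) ≤ φ.maxScaled := by
    rw [hM]; exact Nat.mul_le_mul_right _ (by omega)
  have hyg : y.toRat = (((2 * t + 1) * 2 ^ k : ℕ) : ℚ) * φ.quantum := by
    rw [hmid, hueq, hvQ, ht, hev]; push_cast; ring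
  -- (6) `|x - y| ≤ quantum φ²` (the spacing of `ψ` on the binade is `2·quantum φ²`)
  set D := (φ.qexp - ψ.qexp).toNat with hDdef
  have hDq : φ.quantum = 2 ^ D * ψ.quantum := quantum_eq_two_pow_mul hq
  have hD0 : ((D : ℕ) : ℤ) = φ.qexp - ψ.qexp := Int.toNat_of_nonneg (by omega)
  set S := (2 * φ.qexp - ψ.qexp).toNat with hSdef
  have hS0 : ((S : ℕ) : ℤ) = 2 * φ.qexp - ψ.qexp := Int.toNat_of_nonneg (by omega)
  have hSq : φ.quantum * φ.quantum = 2 ^ S * ψ.quantum := by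
    unfold Format.quantum
    rw [← zpow_natCast, ← zpow_add₀ two_ne_zero, ← zpow_add₀ two_ne_zero, hS0]
    congr 1; ring
  have hkDS : k + D = n + S := by unfold Format.qexp at hD0 hS0; omega
  have habs : |x - y.toRat| ≤ φ.quantum * φ.quantum := by
    have hyz : y.toRat < zM.toRat := by rw [hzM]; exact hymax
    have h0 := abs_sub_roundNE_le_half_ulp_of_pos hy0 hyz
    have hexp : y.expCode - 1 ≤ S + 1 := by
      rcases Nat.lt_or_ge y.expCode 1 with h00 | hE1
      · omega
      · have h3 := pow_le_scaledMag_of_expCode_pos y hE1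
        have hyQ : y.toRat = (y.scaledMag : ℚ) * ψ.quantum := by
          rw [toRat_eq_toInt_mul, toInt_eq_scaledMag_of_nonneg hy0.le]; push_cast; rfl
        have ht2 : ((2 * t + 1 : ℕ) : ℚ) < 2 ^ (φ.manBits + 2) := by
          exact_mod_cast (show 2 * t + 1 < 2 ^ (φ.manBits + 2) by
            rw [pow_succ 2 (φ.manBits + 1)]; omega)
        have h4 : (y.scaledMag : ℚ) * ψ.quantum
            < ((2 ^ (φ.manBits + 2 + k + D) : ℕ) : ℚ) * ψ.quantum := by
          rw [← hyQ, hyg]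
          calc (((2 * t + 1) * 2 ^ k : ℕ) : ℚ) * φ.quantum
              = ((2 * t + 1 : ℕ) : ℚ) * (2 ^ k * φ.quantum) := by push_cast; ring
            _ < (2 : ℚ) ^ (φ.manBits + 2) * (2 ^ k * φ.quantum) :=
                mul_lt_mul_of_pos_right ht2 (by positivity)
            _ = ((2 ^ (φ.manBits + 2 + k + D) : ℕ) : ℚ) * ψ.quantum := by
                rw [hDq]; push_cast; simp only [pow_add]; ring
        have h5 : y.scaledMag < 2 ^ (φ.manBits + 2 + k + D) := by
          exact_mod_cast lt_of_mul_lt_mul_right h4 hQψ.le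
        have h6 := (Nat.pow_lt_pow_iff_right (by norm_num)).mp (h3.trans_lt h5)
        omega
    calc |x - y.toRat| ≤ 2 ^ (y.expCode - 1) * ψ.quantum / 2 := h0
      _ ≤ 2 ^ (S + 1) * ψ.quantum / 2 := by gcongr; norm_num
      _ = φ.quantum * φ.quantum := by rw [hSq, pow_succ]; ring
  -- (7) the integers: `x - y = N·quantum φ²`, `N = A·B + C·Q - (2t+1)·2^n = ±1`
  obtain ⟨N, hN⟩ : ∃ N : ℤ, N = a.toInt * b.toInt + c.toInt * Q - (2 * t + 1) * 2 ^ n := ⟨_, rfl⟩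
  have hxy : x - y.toRat = (N : ℚ) * (φ.quantum * φ.quantum) := by
    have e1 : x = ((a.toInt * b.toInt + c.toInt * Q : ℤ) : ℚ) * (φ.quantum * φ.quantum) := by
      rw [hxdef, toRat_eq_toInt_mul, toRat_eq_toInt_mul, toRat_eq_toInt_mul]; push_cast
      linear_combination (-(c.toInt : ℚ) * φ.quantum) * hQq
    have e2 : y.toRat = (((2 * t + 1) * 2 ^ n : ℤ) : ℚ) * (φ.quantum * φ.quantum) := by
      rw [hyg]; push_cast; rw [← hkey]; ring
    rw [e1, e2, hN]; push_cast; ring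
  have hN1 : |N| ≤ 1 := by
    have h2 : |(N : ℚ) * (φ.quantum * φ.quantum)| ≤ φ.quantum * φ.quantum := by
      rw [← hxy]; exact habs
    rw [abs_mul, abs_of_pos hqq] at h2
    have h3 : |(N : ℚ)| ≤ 1 := le_of_mul_le_mul_right (by linarith) hqq
    exact_mod_cast h3
  have hN0 : N ≠ 0 := by
    intro h0
    apply hxm
    have : x - y.toRat = 0 := by rw [hxy, h0]; simp
    linarith
  have hNcases : N = 1 ∨ N = -1 := by have := abs_le.mp hN1; omega
  -- (8) the sign is forced by the parity of `t`
  have hxg : x = (((2 * t + 1) * 2 ^ k : ℕ) : ℚ) * φ.quantum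
      + (N : ℚ) * (φ.quantum * φ.quantum) := by
    linarith [hxy]
  have hq2k : φ.quantum * φ.quantum < 2 ^ k * φ.quantum := by
    apply mul_lt_mul_of_pos_right _ hQφ
    have hQ2 : (2 : ℚ) ≤ Q := by
      have : 2 ^ 1 ≤ 2 ^ (φ.manBits + (φ.bias - 1)) := Nat.pow_le_pow_right (by norm_num) (by omega)
      rw [hQ]; exact_mod_cast this
    have hk1 : (1 : ℚ) ≤ 2 ^ k := one_le_pow₀ (by norm_num)
    have h2q : 2 * φ.quantum ≤ (Q : ℚ) * φ.quantum := mul_le_mul_of_nonneg_right hQ2 hQφ.le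
    linarith
  have hσe : Even t → N = 1 := by
    intro hte
    rcases hNcases with hN' | hN'
    · exact hN'
    exfalso; apply h
    have hx' : x = (((2 * t + 1) * 2 ^ k : ℕ) : ℚ) * φ.quantum - φ.quantum * φ.quantum := by
      rw [hxg, hN']; push_cast; ring
    show (roundNE φ y.toRat).toRat = (roundNE φ x).toRat
    rw [hyg, toRat_roundNE_gmid h1 hte htlo hthi hu1, hx',
      toRat_roundNE_below_gmid htlo hthi hu1 hqq hq2k]
  have hσo : Odd t → N = -1 := by
    intro hto
    rcases hNcases with hN' | hN'
    swap
    · exact hN'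
    exfalso; apply h
    have hx' : x = (((2 * t + 1) * 2 ^ k : ℕ) : ℚ) * φ.quantum + φ.quantum * φ.quantum := by
      rw [hxg, hN']; push_cast; ring
    show (roundNE φ y.toRat).toRat = (roundNE φ x).toRat
    rw [hyg, toRat_roundNE_gmid_odd h1 hto htlo hthi hu1, hx',
      toRat_roundNE_above_gmid htlo hthi hu1 hqq hq2k]
  -- (9) `A·B` is odd: `|A|, |B| < 2^(m+1)`
  have hNodd : Odd N := by rcases hNcases with rfl | rfl <;> decide
  have h2n : (0 : ℤ) < 2 ^ n := by positivity
  have hABodd : Odd (a.toInt * b.toInt) := by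
    have e : a.toInt * b.toInt = N + (2 * t + 1) * 2 ^ n - c.toInt * Q := by rw [hN]; ring
    rw [e]
    have h2e : Even ((2 * (t : ℤ) + 1) * 2 ^ n) :=
      (Int.even_pow.mpr ⟨even_two, by omega⟩).mul_left _
    have hQe : Even ((c.toInt : ℤ) * Q) := by
      have : Even (Q : ℤ) := by
        rw [hQ]; push_cast; exact Int.even_pow.mpr ⟨even_two, by omega⟩
      exact this.mul_left _
    exact (hNodd.add_even h2e).sub_even hQe
  have hAlt : a.toInt.natAbs < 2 ^ (φ.manBits + 1) := by
    rw [natAbs_toInt]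
    exact scaledMag_lt_of_odd a
      (by rw [← natAbs_toInt, Int.natAbs_odd]; exact (Int.odd_mul.mp hABodd).1)
  have hBlt : b.toInt.natAbs < 2 ^ (φ.manBits + 1) := by
    rw [natAbs_toInt]
    exact scaledMag_lt_of_odd b
      (by rw [← natAbs_toInt, Int.natAbs_odd]; exact (Int.odd_mul.mp hABodd).2)
  have hA0 : 0 < a.toInt.natAbs := by rw [natAbs_toInt]; exact Nat.pos_of_ne_zero ha
  -- `|A·B| + 1 ≤ 2^(2m+2) ≤ 2^(m+n)`
  obtain ⟨P, hP⟩ : ∃ P : ℤ, P = 2 ^ (φ.manBits + 1) := ⟨_, rfl⟩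
  have hABsq : |a.toInt * b.toInt| + 1 ≤ (2 : ℤ) ^ (2 * φ.manBits + 2) := by
    rw [abs_mul, Int.abs_eq_natAbs, Int.abs_eq_natAbs]
    have ha' : ((a.toInt.natAbs : ℕ) : ℤ) ≤ P - 1 := by
      have : ((a.toInt.natAbs : ℕ) : ℤ) < 2 ^ (φ.manBits + 1) := by exact_mod_cast hAlt
      omega
    have hb' : ((b.toInt.natAbs : ℕ) : ℤ) ≤ P - 1 := by
      have : ((b.toInt.natAbs : ℕ) : ℤ) < 2 ^ (φ.manBits + 1) := by exact_mod_cast hBlt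
      omega
    have ha0 : (0 : ℤ) ≤ ((a.toInt.natAbs : ℕ) : ℤ) := by positivity
    have hb0' : (0 : ℤ) ≤ ((b.toInt.natAbs : ℕ) : ℤ) := by positivity
    have hsq : (2 : ℤ) ^ (2 * φ.manBits + 2) = P * P := by
      rw [hP, ← pow_add]; congr 1; ring
    rw [hsq]
    exact mul_add_one_le_mul_self ha' hb' ha0 hb0'
  have hmn : (2 : ℤ) ^ (2 * φ.manBits + 2) ≤ 2 ^ (φ.manBits + n) :=
    pow_le_pow_right₀ (by norm_num) (by omega)
  -- (10) `C·Q > 2^(m+n)`: `c` is positive, above `W/2 = 2^(m+k)` quanta, a multiple of `2^k`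
  have hCQ : (2 : ℤ) ^ (φ.manBits + n) < c.toInt * Q := by
    have e : c.toInt * (Q : ℤ) = N + (2 * t + 1) * 2 ^ n - a.toInt * b.toInt := by rw [hN]; ring
    rw [e]
    have htz : (2 : ℤ) ^ φ.manBits ≤ t := by exact_mod_cast htlo
    have ht2 : (2 : ℤ) ^ (φ.manBits + n) * 2 + 2 ^ n ≤ (2 * (t : ℤ) + 1) * 2 ^ n := by
      have h7 : (2 : ℤ) ^ φ.manBits * 2 ^ n ≤ (t : ℤ) * 2 ^ n :=
        mul_le_mul_of_nonneg_right htz h2n.le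
      rw [pow_add]; linarith
    have hABl := (abs_lt.mp (lt_of_lt_of_le (by linarith : |a.toInt * b.toInt|
      < (2 : ℤ) ^ (2 * φ.manBits + 2)) hmn)).2
    have hNl := (abs_le.mp hN1).1
    linarith
  have hC0 : 0 < c.toInt := by
    have : (0 : ℤ) < c.toInt * Q := lt_trans (by positivity) hCQ
    exact (mul_pos_iff_of_pos_right (by exact_mod_cast hQpos)).mp this
  have hc0 : 0 ≤ c.toRat := by
    rw [toRat_eq_toInt_mul]; exact mul_nonneg (by exact_mod_cast hC0.le) hQφ.le
  have hCmag : c.toInt = (c.scaledMag : ℤ) := toInt_eq_scaledMag_of_nonneg hc0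
  have hClt : 2 ^ (φ.manBits + k) < c.scaledMag := by
    have h3 : (2 : ℤ) ^ (φ.manBits + k) * Q = 2 ^ (φ.manBits + n) := by
      rw [pow_add, mul_assoc, hkQz, ← pow_add]
    have h4 : (2 : ℤ) ^ (φ.manBits + k) * Q < (c.scaledMag : ℤ) * Q := by
      rw [h3, ← hCmag]; exact hCQ
    have hQz : (0 : ℤ) < Q := by exact_mod_cast hQpos
    exact_mod_cast lt_of_mul_lt_mul_right h4 hQz.le
  obtain ⟨w, hCw, hwpar⟩ := exists_eq_mul_pow_of_lt (representable_scaledMag c) hClt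
  have hwlo : 2 ^ φ.manBits < w := by
    by_contra hle
    push Not at hle
    have : c.scaledMag ≤ 2 ^ (φ.manBits + k) := by
      rw [hCw, pow_add]; exact Nat.mul_le_mul_right _ hle
    omega
  have hwhi : w ≤ 2 ^ (φ.manBits + 1) + 2 * J := by
    have h5 : w * 2 ^ k ≤ (2 ^ φ.manBits + J) * 2 * 2 ^ k := by
      have := scaledMag_le_maxScaled c
      rwa [hM, hCw, pow_succ', ← mul_assoc] at this
    have := Nat.le_of_mul_le_mul_right h5 (by positivity)
    rw [pow_succ]; omega
  -- (11) `A·B = e·2^n + N`, `e = 2t + 1 - w`, `|e| ≤ 2^(2m+2-n)`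
  have hAB : a.toInt * b.toInt = (2 * (t : ℤ) + 1 - w) * 2 ^ n + N := by
    have e1 : c.toInt * (Q : ℤ) = (w : ℤ) * 2 ^ n := by
      rw [hCmag, hCw]; push_cast; rw [← hkQz]; ring
    linear_combination (-1 : ℤ) * hN - e1
  have he : |2 * (t : ℤ) + 1 - w| ≤ 2 ^ (2 * φ.manBits + 2 - n) := by
    have h6 : |2 * (t : ℤ) + 1 - w| * 2 ^ n ≤ 2 ^ (2 * φ.manBits + 2) := by
      have e1 : (2 * (t : ℤ) + 1 - w) * 2 ^ n = a.toInt * b.toInt - N := by rw [hAB]; ring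
      have h7 : |(2 * (t : ℤ) + 1 - w) * 2 ^ n| ≤ |a.toInt * b.toInt| + |N| := by
        rw [e1]; exact abs_sub _ _
      rw [abs_mul, abs_of_pos h2n] at h7
      linarith
    have h8 : (2 : ℤ) ^ (2 * φ.manBits + 2) ≤ 2 ^ (2 * φ.manBits + 2 - n) * 2 ^ n := by
      rw [← pow_add]; exact pow_le_pow_right₀ (by norm_num) le_tsub_add
    exact le_of_mul_le_mul_right (h6.trans h8) h2n
  -- (12) the parity of `t` is the parity of `j = t - 2^m` (`m ≥ 1`)
  have h2m : 2 ^ φ.manBits % 2 = 0 := Nat.even_iff.mp (Nat.even_pow.mpr ⟨even_two, by omega⟩)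
  have hσ : (if (t - 2 ^ φ.manBits) % 2 = 0 then (1 : ℤ) else -1) = N := by
    rcases Nat.even_or_odd t with hte | hto
    · have : (t - 2 ^ φ.manBits) % 2 = 0 := by have := Nat.even_iff.mp hte; omega
      rw [if_pos this, hσe hte]
    · have : ¬ (t - 2 ^ φ.manBits) % 2 = 0 := by have := Nat.odd_iff.mp hto; omega
      rw [if_neg this, hσo hto]
  -- (13) the test
  refine fmaBinadeSlipTest_eq_true_of (j := t - 2 ^ φ.manBits) (e := 2 * (t : ℤ) + 1 - w)
    (by omega) he ?_
  have hcast : ((t - 2 ^ φ.manBits : ℕ) : ℤ) = (t : ℤ) - 2 ^ φ.manBits := by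
    rw [Nat.cast_sub htlo]; push_cast; ring
  simp only [fmaBinadeCond, Bool.and_eq_true, Bool.or_eq_true, decide_eq_true_eq, hσ, hcast]
  have hwlo' : (2 : ℤ) ^ φ.manBits < w := by exact_mod_cast hwlo
  have hwhi' : (w : ℤ) ≤ 2 ^ (φ.manBits + 1) + 2 * J := by exact_mod_cast hwhi
  refine ⟨⟨⟨by linarith, by linarith⟩, ?_⟩, ?_⟩
  · rcases hwpar with h0 | h0
    · left; have : (w : ℤ) < 2 ^ (φ.manBits + 1) := by exact_mod_cast h0
      linarith
    · right; have : (w : ℤ) % 2 = 0 := by exact_mod_cast h0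
      have e1 : 2 * ((2 : ℤ) ^ φ.manBits + (t - 2 ^ φ.manBits)) + 1 - (2 * t + 1 - w) = w := by
        ring
      rw [e1]; exact this
  · have e1 : (2 * (t : ℤ) + 1 - w) * 2 ^ n + N = a.toInt * b.toInt := hAB.symm
    rw [e1, Int.natAbs_mul]
    exact twoSigTest_mul_eq_true hA0 hAlt hBlt


end Summit.Ventures.CertifiedArithmetic
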